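import Literature.NumberTheory.GaloisRepresentations.InertiaCohomologyTorsionBound
import Literature.NumberTheory.GaloisRepresentations.ContinuousCohomologyAdditiveTransport
import Literature.NumberTheory.GaloisRepresentations.AbsGaloisGroupCompact
import Literature.NumberTheory.GaloisRepresentations.ContinuousCorestriction
import Literature.NumberTheory.EllipticCurves.SelmerCocycleLiftUnramifiedFiniteProofs
import Literature.NumberTheory.EllipticCurves.ZpExtensionUnramifiedProofs
import Literature.NumberTheory.EllipticCurves.IsogenyGeomEndRingOrdinaryCommProofs
import Literature.NumberTheory.EllipticCurves.KummerMap
import Literature.NumberTheory.EllipticCurves.PrimaryTorsionGaloisRep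
import Literature.NumberTheory.EllipticCurves.BigGaloisRepSelmer
import HarnessLib

/-!
# `H¹(I_F, A)` is finite for an `ℓ`-primary divisible discrete module with finitely many
# `I_F`-fixed points (`ℓ ≠` residue characteristic); the case `A = E[p^∞]` (theorems only)

Topics `NumberTheory/GaloisRepresentations` ∕ `NumberTheory/EllipticCurves`. THEOREMS ONLY (no
definition, no named fact, no `sorry`). Cell `bsd-stepL`, K2 support 20495 (`JSWSigmaLocalCharIdeal`),
module L5, input (A2) of `JetchevSkinnerWan2017.sigmaLocal_of_ne_zero_of_finite_inertia`.

Let `F` be a non-archimedean local field with inertia group `I_F = absInertia F`, `ℓ` a prime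
different from the residue characteristic, and `A` a discrete `Γ_F`-module which is `ℓ`-primary,
`ℓ^k`-divisible with finite `A[ℓ^k]` for every `k` (e.g. `E[ℓ^∞]`). The tree's
`natCard_torsionBy_continuousCohomology_one_absInertia_le` (Serre *Local Fields* IV §2, XIII §1;
Milne *ADT* I 2.9) bounds `#H¹(I_F, A)[ℓ^k] ≤ #(A[ℓ^k])^{I_F} ≤ #A^{I_F}` UNIFORMLY in `k`; since
`H¹(I_F, A)` is `ℓ`-primary (`BigGaloisRep.exists_pow_smul_eq_zero`: cocycles on a compact group with
discrete torsion values), finiteness of `A^{I_F}` forces finiteness of `H¹(I_F, A)`: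

* `finite_continuousCohomology_one_absInertia_of_finite_fixed` — the general statement (`ℤ`-typed
  representation, as in `InertiaCohomologyTorsionBound`);
* `WeierstrassCurve.finite_h1_absInertia_primaryTorsion_of_finite_fixed` — **for an elliptic curve
  `E` over a number field `K : Type`, a prime `p`, a place `w ∤ p`: if `E[p^∞]^{I_w}` is finite then
  `H¹(I_w, E[p^∞])` is finite**, in the `ℤ_p`-typed `subgroupRep` currency of the local `Σ`-atom
  (hypothesis `hfinH` of `sigmaLocal_of_ne_zero_of_finite_inertia`; transport of scalars `ℤ_p ↝ ℤ` by
  `continuousCohomologyAddEquiv`). With `InertiaInvariantsPrimaryTorsionAdditiveProofs` (finiteness of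
  `E[p^∞]^{I_w}` at the additive places) this settles both inertia inputs at the additive places.

In corank language this is Greenberg–Vatsal's remark that `𝓗_ℓ = 0` at the additive primes with
`E[p^∞]^{I_ℓ}` finite (Invent. Math. 142 (2000), §2, proof of Prop. 2.4).

## References

* [SerreLocalFields1979] J.-P. Serre, *Local Fields* (1979), Ch. IV §2, Ch. XIII §1.
* [MilneADT2006] J. S. Milne, *Arithmetic Duality Theorems* (2006), I §2 Lemma 2.9.
* [SerreGaloisCohomology1997] J.-P. Serre, *Galois Cohomology* (1997), I §2.2.
* [GreenbergVatsal2000] R. Greenberg, V. Vatsal, Invent. Math. 142 (2000), §2 Prop. 2.4.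
-/

noncomputable section

open scoped Classical
open CategoryTheory Function Field ValuativeRel NumberField IsDedekindDomain
  IsDedekindDomain.HeightOneSpectrum
open Literature.NumberTheory.EllipticCurves Literature.NumberTheory.EllipticCurves.BigGaloisRep
  Literature.NumberTheory.GaloisRepresentations Literature.NumberTheory.Automorphic
  Literature.NumberTheory.GaloisRepresentations.IsNonarchimedeanLocalField

universe u

namespace Literature.NumberTheory.GaloisRepresentations

open _root_.TopRep _root_.ContinuousCohomology

section Local

variable (F : Type u) [Field F] [ValuativeRel F] [TopologicalSpace F] [IsNonarchimedeanLocalField F]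
variable {A : Type u} [AddCommGroup A] [TopologicalSpace A] [DiscreteTopology A]

/-- **`H¹(I_F, A)` is finite** for a discrete `Γ_F`-module `A` which is `ℓ`-primary, `ℓ^k`-divisible
with finite `A[ℓ^k]` for all `k`, `ℓ` prime to the residue characteristic, and with FINITELY MANY
`I_F`-fixed points: `#H¹(I_F, A)[ℓ^k] ≤ #(A[ℓ^k])^{I_F} ≤ #A^{I_F}` uniformly in `k`
(`natCard_torsionBy_continuousCohomology_one_absInertia_le`) and `H¹(I_F, A)` is `ℓ`-primary.
[cite: SerreLocalFields1979, Ch. IV §2 Cor. 1, Cor. 3 of Prop. 7 and Ch. XIII §1 Prop. 1]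
[cite: MilneADT2006, I §2 Lemma 2.9] [cite: SerreGaloisCohomology1997, I §2.2] -/
theorem finite_continuousCohomology_one_absInertia_of_finite_fixed
    (ρ : ContinuousRep (absoluteGaloisGroup F) ℤ A) {ℓ : ℕ} [Fact ℓ.Prime] (hℓ : ringChar 𝓀[F] ≠ ℓ)
    (htors : ∀ a : A, ∃ n : ℕ, ℓ ^ n • a = 0)
    (hdiv : ∀ (k : ℕ) (a : A), ∃ b : A, ℓ ^ k • b = a)
    (hfin : ∀ k : ℕ, Finite (Submodule.torsionBy ℤ A ((ℓ ^ k : ℕ) : ℤ)))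
    (hfix : Set.Finite {a : A | ∀ σ ∈ absInertia F, ρ σ a = a}) :
    Finite (continuousCohomology 1 ((ρ.restrict (subgroupIncl (absInertia F))).toTopRep)) := by
  haveI : CompactSpace (absoluteGaloisGroup F) := absoluteGaloisGroup_compactSpace F
  haveI : CompactSpace (absInertia F) :=
    isCompact_iff_compactSpace.mp (isClosed_absInertia_holds F).isCompact
  haveI := hfix.to_subtype
  set X := (ρ.restrict (subgroupIncl (absInertia F))).toTopRep with hX
  -- the uniform bound on the `ℓ^k`-torsion
  have hlevel : ∀ k : ℕ, Finite (Submodule.torsionBy ℤ (continuousCohomology 1 X) ((ℓ ^ k : ℕ) : ℤ)) ∧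
      Nat.card (Submodule.torsionBy ℤ (continuousCohomology 1 X) ((ℓ ^ k : ℕ) : ℤ)) ≤
        Nat.card {a : A | ∀ σ ∈ absInertia F, ρ σ a = a} := by
    intro k
    haveI := hfin k
    have hcop : (ℓ ^ k).Coprime (ringChar 𝓀[F]) := by
      refine Nat.Coprime.pow_left k ((Nat.coprime_primes (Fact.out : ℓ.Prime)
        (ringChar_residueField_prime (F := F))).mpr (Ne.symm hℓ))
    refine ⟨finite_torsionBy_continuousCohomology_one_absInertia F ρ hcop (hdiv k), ?_⟩
    refine (natCard_torsionBy_continuousCohomology_one_absInertia_le F ρ hcop (hdiv k)).trans ?_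
    refine Nat.card_le_card_of_injective
      (fun a ↦ (⟨((a.1 : Submodule.torsionBy ℤ A ((ℓ ^ k : ℕ) : ℤ)) : A), a.2⟩ :
        {a : A | ∀ σ ∈ absInertia F, ρ σ a = a})) fun a b hab ↦ ?_
    have h1 := Subtype.ext_iff.mp hab
    exact Subtype.ext (Subtype.ext h1)
  -- `H¹(I_F, A)` is `ℓ`-primary
  have hprim : ∀ y : continuousCohomology 1 X, ∃ n : ℕ,
      y ∈ Submodule.torsionBy ℤ (continuousCohomology 1 X) ((ℓ ^ n : ℕ) : ℤ) := by
    intro y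
    obtain ⟨n, hn⟩ := BigGaloisRep.exists_pow_smul_eq_zero X (ℓ : ℤ) (fun m ↦ by
      obtain ⟨n, hn⟩ := htors m
      exact ⟨n, by rw [← Nat.cast_pow, Nat.cast_smul_eq_nsmul]; exact hn⟩) y
    refine ⟨n, ?_⟩
    rw [Submodule.mem_torsionBy_iff, Nat.cast_pow]
    exact hn
  -- a finite set of `#A^{I_F} + 1` classes would sit in one `H¹[ℓ^N]`
  by_contra hinf
  rw [not_finite_iff_infinite] at hinf
  obtain ⟨S, hS⟩ := Infinite.exists_subset_card_eq (continuousCohomology 1 X)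
    (Nat.card {a : A | ∀ σ ∈ absInertia F, ρ σ a = a} + 1)
  choose n hn using hprim
  have hmem : ∀ y ∈ S,
      y ∈ Submodule.torsionBy ℤ (continuousCohomology 1 X) ((ℓ ^ S.sup n : ℕ) : ℤ) := by
    intro y hy
    refine Submodule.torsionBy_le_torsionBy_of_dvd _ _ ?_ (hn y)
    rw [Nat.cast_pow, Nat.cast_pow]
    exact pow_dvd_pow _ (Finset.le_sup (f := n) hy)
  obtain ⟨hfinN, hcardN⟩ := hlevel (S.sup n)
  have hle : S.card ≤
      Nat.card (Submodule.torsionBy ℤ (continuousCohomology 1 X) ((ℓ ^ S.sup n : ℕ) : ℤ)) := by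
    haveI := hfinN
    let ev : {y // y ∈ S} →
        Submodule.torsionBy ℤ (continuousCohomology 1 X) ((ℓ ^ S.sup n : ℕ) : ℤ) :=
      fun y ↦ ⟨y.1, hmem y.1 y.2⟩
    have hev : Injective ev := fun a b hab ↦ by
      have h1 := Subtype.ext_iff.mp hab
      exact Subtype.ext h1
    rw [← Nat.card_eq_finsetCard]
    exact Nat.card_le_card_of_injective ev hev
  omega

end Local

end Literature.NumberTheory.GaloisRepresentations

/-! ### The case `A = E[p^∞]` at a place `w ∤ p` of a number field -/

namespace WeierstrassCurve

open Literature.NumberTheory.GaloisRepresentations _root_.TopRep _root_.ContinuousCohomology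

variable {K : Type} [Field K] [NumberField K] (W : WeierstrassCurve K) [W.IsElliptic]
  (p : ℕ) [Fact p.Prime] {w : HeightOneSpectrum (𝓞 K)}

omit [W.IsElliptic] in
/-- `E[p^∞]` is `p^k`-divisible: `E(K̄)` is divisible (`zsmul_geomPoints_surjective_of_charZero`) and a
`p^k`-th root of a `p`-power torsion point is `p`-power torsion.
[cite: SilvermanAEC2009, §VIII.2 (`[m] : E(K̄) → E(K̄)` is onto)] -/
theorem exists_prime_pow_nsmul_eq_primaryTorsion (k : ℕ) (a : PrimaryTorsion (geomPoints W) p) :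
    ∃ b : PrimaryTorsion (geomPoints W) p, p ^ k • b = a := by
  obtain ⟨m, hm⟩ := a.exists_pow_smul_eq_zero
  have hpk : ((p ^ k : ℕ) : ℤ) ≠ 0 :=
    Int.natCast_ne_zero.2 (pow_ne_zero k (Fact.out : p.Prime).ne_zero)
  obtain ⟨Q, hQ⟩ := W.zsmul_geomPoints_surjective_of_charZero hpk (a : geomPoints W)
  have hQ' : p ^ k • Q = (a : geomPoints W) := by rw [← natCast_zsmul]; exact hQ
  have hQm : p ^ (m + k) • Q = 0 := by rw [pow_add, mul_smul, hQ', hm]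
  exact ⟨PrimaryTorsion.mk Q (m + k) hQm, PrimaryTorsion.ext (by
    rw [PrimaryTorsion.val_nsmul, PrimaryTorsion.val_mk, hQ'])⟩

omit [NumberField K] in
/-- `E[p^∞][p^k]` (the `(p^k : ℤ)`-torsion of `PrimaryTorsion (geomPoints E) p`) is finite: it injects
into `E[p^k]`, finite by `finite_geomTorsion_natCast`. [cite: SilvermanAEC2009, Cor. III.6.4] -/
theorem finite_torsionBy_int_primaryTorsion (k : ℕ) :
    Finite (Submodule.torsionBy ℤ (PrimaryTorsion (geomPoints W) p) ((p ^ k : ℕ) : ℤ)) := by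
  haveI : Finite (geomTorsion W ((p ^ k : ℕ) : ℤ)) :=
    finite_geomTorsion_natCast W (pow_ne_zero k (Fact.out : p.Prime).ne_zero)
  refine Finite.of_injective
    (fun x : Submodule.torsionBy ℤ (PrimaryTorsion (geomPoints W) p) ((p ^ k : ℕ) : ℤ) ↦
      (⟨((x : PrimaryTorsion (geomPoints W) p) : geomPoints W), by
        rw [mem_geomTorsion_iff, natCast_zsmul]
        have hx := (Submodule.mem_torsionBy_iff _ _).1 x.2
        rw [Nat.cast_smul_eq_nsmul] at hx
        have hx' := congrArg (fun y : PrimaryTorsion (geomPoints W) p ↦ (y : geomPoints W)) hx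
        simpa only [PrimaryTorsion.val_nsmul, PrimaryTorsion.val_zero] using hx'⟩ :
        geomTorsion W ((p ^ k : ℕ) : ℤ))) fun x y hxy ↦ ?_
  have h1 := Subtype.ext_iff.mp hxy
  exact Subtype.ext (PrimaryTorsion.ext h1)

/-- **`H¹(I_w, E[p^∞])` is finite as soon as `E[p^∞]^{I_w}` is**, at a place `w ∤ p` of a number field
`K : Type`, in the currency of the local `Σ`-atom: `Γ_{K_w}` acting on `PrimaryTorsion (geomPoints E) p`
through `localMap K (inl w)`, `I_w = absInertia K_w`, `H¹` of the `ℤ_p`-typed `subgroupRep`. The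
hypothesis is `hfinI` and the conclusion is `hfinH` of
`JetchevSkinnerWan2017.sigmaLocal_of_ne_zero_of_finite_inertia`; at an ADDITIVE place the hypothesis
is `finite_setOf_primaryTorsionGaloisRep_localMap_fixed_of_hasAdditiveReductionAt`.
[cite: SerreLocalFields1979, Ch. IV §2 and Ch. XIII §1 Prop. 1] [cite: MilneADT2006, I §2 Lemma 2.9]
[cite: GreenbergVatsal2000, §2, proof of Prop. 2.4 (additive primes)] -/
theorem finite_h1_absInertia_primaryTorsion_of_finite_fixed (hw : ((p : ℕ) : 𝓞 K) ∉ w.asIdeal)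
    [ContinuousSMul ℤ_[p] (PrimaryTorsion (geomPoints W) p)]
    (hfinI : Set.Finite {a : PrimaryTorsion (geomPoints W) p |
      ∀ σ ∈ absInertia (w.adicCompletion K),
        (W.primaryTorsionGaloisRep p) (localMap K (Sum.inl w) σ) a = a}) :
    Finite (continuousCohomology 1 (subgroupRep
      (((W.primaryTorsionGaloisRep p).restrict (localMap K (Sum.inl w)) :
        ContinuousRep (absoluteGaloisGroup (w.adicCompletion K)) ℤ_[p]
          (PrimaryTorsion (geomPoints W) p))).toTopRep
        (absInertia (w.adicCompletion K)))) := by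
  set ρw : ContinuousRep (absoluteGaloisGroup (w.adicCompletion K)) ℤ_[p]
      (PrimaryTorsion (geomPoints W) p) :=
    (W.primaryTorsionGaloisRep p).restrict (localMap K (Sum.inl w)) with hρw
  set ρZ : ContinuousRep (absoluteGaloisGroup (w.adicCompletion K)) ℤ (PrimaryTorsion (geomPoints W) p) :=
    ρw.restrictScalars ℤ with hρZ
  have hZ : Finite (continuousCohomology 1
      ((ρZ.restrict (Literature.NumberTheory.GaloisRepresentations.subgroupIncl
        (absInertia (w.adicCompletion K)))).toTopRep)) :=
    finite_continuousCohomology_one_absInertia_of_finite_fixed (w.adicCompletion K) ρZ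
      (ℓ := p) (w.ringChar_residueField_adicCompletion_ne hw)
      (fun a ↦ (a.exists_pow_smul_eq_zero).imp fun n hn ↦
        PrimaryTorsion.ext (by rw [PrimaryTorsion.val_nsmul, PrimaryTorsion.val_zero]; exact hn))
      (fun k a ↦ W.exists_prime_pow_nsmul_eq_primaryTorsion p k a)
      (fun k ↦ W.finite_torsionBy_int_primaryTorsion p k) hfinI
  -- `H¹` does not see the scalars (`ℤ` vs `ℤ_p`): same cochains
  let η : PrimaryTorsion (geomPoints W) p ≃ₜ+ PrimaryTorsion (geomPoints W) p :=
    ContinuousAddEquiv.refl _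
  have hη : ∀ (g : absInertia (w.adicCompletion K)) (x : PrimaryTorsion (geomPoints W) p),
      η ((ρZ.restrict (Literature.NumberTheory.GaloisRepresentations.subgroupIncl
          (absInertia (w.adicCompletion K)))).toTopRep.ρ g x) =
        (subgroupRep ρw.toTopRep (absInertia (w.adicCompletion K))).ρ g (η x) :=
    fun _ _ ↦ rfl
  exact Finite.of_equiv _ (continuousCohomologyAddEquiv
    (X := (ρZ.restrict (Literature.NumberTheory.GaloisRepresentations.subgroupIncl
      (absInertia (w.adicCompletion K)))).toTopRep)
    (Y := subgroupRep ρw.toTopRep (absInertia (w.adicCompletion K))) η hη 1).toEquiv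

end WeierstrassCurve

end
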